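import Mathlib

/-!
# Crux `ExtremalBiaxialitySubcritical` (stmt-NavierStokesRegularity-11609), negative side:
# the middle strain eigenvalue is a saddle functional, and the first-order record budget closes

Route `SqueezeCycle`, crux `Summit.NavierStokesRegularity.NavierStokesRegularity.Theses.SqueezeCycle.ExtremalBiaxialitySubcritical`
("an attained class-wide maximum `m` of the Leray-gauge middle strain eigenvalue `Λ = (−t)λ₂(S)`
over the Type-I model class `𝒦_C` satisfies `m < 1/8`"). This file records two OBSTRUCTIONS to
pointwise arguments at the record, extracted from the crux work file
`Cruxes/ExtremalBiaxialitySubcritical/Disproof.lean` (cdisprove adversary, D-0016); pure `Mathlib`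
content, no route declaration is mentioned.

* `midEigenvalue_not_midpointConvex` / `midEigenvalue_not_midpointConcave` — **saddle no-go**:
  explicit trace-free symmetric `S₀, H` (resp. `S₁, H'`) with `λ₂(S₀ ± H) = 0 < 9/5 = λ₂(S₀)`
  (resp. `λ₂(S₁ ± H') = 0 > −9/5 = λ₂(S₁)`), certified in the crux's own Courant–Fischer two-frame
  currency (`Literature.Analysis.FluidPDE.eigenvalues_mid_le_iff` / `le_eigenvalues_mid_iff`
  convert). So `λ₂` is neither midpoint-convex nor midpoint-concave on trace-free symmetric
  matrices: no convex `F ≤ λ₂` and no concave `F ≥ λ₂` can touch `λ₂` at a simple-spectrum point,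
  hence the middle eigenvalue of a matrix field evolving by a linear (heat / Stokes-type) equation
  is neither a sub- nor a supersolution — maximum-principle, comparison, Harnack and strong-maximum
  arguments do not act on `Λ` (level repulsion: `d²λ₂[H] = 2|H₀₁|²/(λ₂−λ₁) + 2|H₁₂|²/(λ₂−λ₃)`).
* `localBudget_selfPaid` / `localBudget_thresholds` — the first-order budget at an attained record
  `Λ = m` (gauge frame of `𝔖`, `e₂` middle):
  `0 = −m − m² + |𝔖|²/3 + |Ω|²/12 − (Ω·e₂)²/4 − ℌ^dev₂₂ + 𝒱₂₂`
  is satisfiable for EVERY `m > 0` with zero vorticity, zero deviatoric pressure Hessian and a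
  dissipative viscous term, by the strain shape `diag(km, m, −(k+1)m)` with `k ≥ k*(m) =
  (−1 + √(3 + 6/m))/2` (`k*(1) = 1`, `k*(1/4) ≈ 2.10`, `k*(1/8) ≈ 3.07`): restricted-Euler
  self-amplification alone pays the bill, so first-order optimality at the record bounds nothing.
-/

namespace Summit.NavierStokesRegularity.NavierStokesRegularity.Theorems.ExtremalBiaxialitySubcritical.Negative

open Matrix

/-- **Saddle no-go, concave direction: the middle eigenvalue is not midpoint-convex.** With the
trace-free symmetric `S₀ = diag(9/5, 16/5, −5)` and `H = (12/5)(E₀₁ + E₁₀)` (coupling the middle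
and the TOP eigen-directions of `S₀`; `S₀ ± H` has spectrum `{5, 0, −5}`, eigenvectors
`(3, ±4, 0)/5`, `(4, ∓3, 0)/5`, `e₂`): the quadratic form of `S₀` is `≥ (9/5)|·|²` on the
orthonormal two-frame `(e₀, e₁)` (so `λ₂(S₀) ≥ 9/5`, Courant–Fischer max–min,
`Literature.Analysis.FluidPDE.le_eigenvalues_mid_iff`), while the quadratic forms of `S₀ + H` and
`S₀ − H` are `≤ 0` on the orthonormal two-frames `((4,−3,0)/5, e₂)` resp. `((4,3,0)/5, e₂)` (so
`λ₂(S₀ ± H) ≤ 0`, min–max, `eigenvalues_mid_le_iff`). Hence `λ₂(½(A+B)) > ½(λ₂A + λ₂B)` for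
`A, B = S₀ ± H`: no convex `F ≤ λ₂` touches `λ₂` at `S₀`, the middle eigenvalue of a matrix field
evolving linearly is not a subsolution, and no maximum-principle / comparison argument bounds an
interior maximum of `Λ` from above (level repulsion from the top eigenvalue:
`d²λ₂[H] = 2|H₀₁|²/(λ₂−λ₁) + 2|H₁₂|²/(λ₂−λ₃)`). [folklore] -/
theorem midEigenvalue_not_midpointConvex :
    (!![9/5, 0, 0; 0, 16/5, 0; 0, 0, -5] : Matrix (Fin 3) (Fin 3) ℝ).trace = 0 ∧ (!![0, 12/5, 0; 12/5, 0, 0; 0, 0, 0] : Matrix (Fin 3) (Fin 3) ℝ).trace = 0 ∧ (!![9/5, 0, 0; 0, 16/5, 0; 0, 0, -5] : Matrix (Fin 3) (Fin 3) ℝ).IsSymm ∧ (!![0, 12/5, 0; 12/5, 0, 0; 0, 0, 0] : Matrix (Fin 3) (Fin 3) ℝ).IsSymm ∧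
      (∃ a b : Fin 3 → ℝ, a ⬝ᵥ a = 1 ∧ b ⬝ᵥ b = 1 ∧ a ⬝ᵥ b = 0 ∧
        ∀ α β : ℝ, (9 / 5) * (α ^ 2 + β ^ 2) ≤ (α • a + β • b) ⬝ᵥ ((!![9/5, 0, 0; 0, 16/5, 0; 0, 0, -5] : Matrix (Fin 3) (Fin 3) ℝ) *ᵥ (α • a + β • b))) ∧
      (∃ a b : Fin 3 → ℝ, a ⬝ᵥ a = 1 ∧ b ⬝ᵥ b = 1 ∧ a ⬝ᵥ b = 0 ∧
        ∀ α β : ℝ, (α • a + β • b) ⬝ᵥ (((!![9/5, 0, 0; 0, 16/5, 0; 0, 0, -5] : Matrix (Fin 3) (Fin 3) ℝ) + (!![0, 12/5, 0; 12/5, 0, 0; 0, 0, 0] : Matrix (Fin 3) (Fin 3) ℝ)) *ᵥ (α • a + β • b)) ≤ 0 * (α ^ 2 + β ^ 2)) ∧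
      (∃ a b : Fin 3 → ℝ, a ⬝ᵥ a = 1 ∧ b ⬝ᵥ b = 1 ∧ a ⬝ᵥ b = 0 ∧
        ∀ α β : ℝ, (α • a + β • b) ⬝ᵥ (((!![9/5, 0, 0; 0, 16/5, 0; 0, 0, -5] : Matrix (Fin 3) (Fin 3) ℝ) - (!![0, 12/5, 0; 12/5, 0, 0; 0, 0, 0] : Matrix (Fin 3) (Fin 3) ℝ)) *ᵥ (α • a + β • b)) ≤ 0 * (α ^ 2 + β ^ 2)) := by
  refine ⟨?_, ?_, ?_, ?_, ?_, ?_, ?_⟩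
  · simp [Matrix.trace, Fin.sum_univ_three]; norm_num
  · simp [Matrix.trace, Fin.sum_univ_three]
  · exact Matrix.IsSymm.ext fun i j => by fin_cases i <;> fin_cases j <;> simp
  · exact Matrix.IsSymm.ext fun i j => by fin_cases i <;> fin_cases j <;> simp
  · refine ⟨![1, 0, 0], ![0, 1, 0], by simp, by simp, by simp, fun α β => ?_⟩
    simp [Matrix.mulVec, dotProduct, Fin.sum_univ_three]
    nlinarith [sq_nonneg β]
  · refine ⟨![4/5, -3/5, 0], ![0, 0, 1], ?_, ?_, ?_, fun α β => ?_⟩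
    · simp [dotProduct, Fin.sum_univ_three]; norm_num
    · simp [dotProduct, Fin.sum_univ_three]
    · simp [dotProduct, Fin.sum_univ_three]
    · simp [Matrix.mulVec, dotProduct, Fin.sum_univ_three]
      nlinarith [sq_nonneg β]
  · refine ⟨![4/5, 3/5, 0], ![0, 0, 1], ?_, ?_, ?_, fun α β => ?_⟩
    · simp [dotProduct, Fin.sum_univ_three]; norm_num
    · simp [dotProduct, Fin.sum_univ_three]
    · simp [dotProduct, Fin.sum_univ_three]
    · simp [Matrix.mulVec, dotProduct, Fin.sum_univ_three]
      nlinarith [sq_nonneg β]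

/-- **Saddle no-go, convex direction: the middle eigenvalue is not midpoint-concave either.** With
the trace-free symmetric `S₁ = diag(5, −16/5, −9/5)` and `H' = (12/5)(E₁₂ + E₂₁)` (coupling the
middle and the BOTTOM eigen-directions; `S₁ ± H'` has spectrum `{5, 0, −5}`, eigenvectors `e₀`,
`(0,3,±4)/5`, `(0,4,∓3)/5`): the quadratic form of `S₁` is `≤ −(9/5)|·|²` on `(e₁, e₂)`
(`λ₂(S₁) ≤ −9/5`) while the quadratic forms of `S₁ ± H'` are `≥ 0` on `(e₀, (0,3,±4)/5)`
(`λ₂(S₁ ± H') ≥ 0`). Hence no concave `F ≥ λ₂` touches at `S₁`: `Λ` is not a supersolution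
either — no minimum principle / Harnack from below. Together with
`midEigenvalue_not_midpointConvex`, `λ₂` is a genuine saddle functional of the strain, which is
why the viscous term `e₂ᵀ(ΔS)e₂` has no sign at a spatial extremum of `λ₂(S(x))`. [folklore] -/
theorem midEigenvalue_not_midpointConcave :
    (!![5, 0, 0; 0, -16/5, 0; 0, 0, -9/5] : Matrix (Fin 3) (Fin 3) ℝ).trace = 0 ∧ (!![0, 0, 0; 0, 0, 12/5; 0, 12/5, 0] : Matrix (Fin 3) (Fin 3) ℝ).trace = 0 ∧ (!![5, 0, 0; 0, -16/5, 0; 0, 0, -9/5] : Matrix (Fin 3) (Fin 3) ℝ).IsSymm ∧ (!![0, 0, 0; 0, 0, 12/5; 0, 12/5, 0] : Matrix (Fin 3) (Fin 3) ℝ).IsSymm ∧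
      (∃ a b : Fin 3 → ℝ, a ⬝ᵥ a = 1 ∧ b ⬝ᵥ b = 1 ∧ a ⬝ᵥ b = 0 ∧
        ∀ α β : ℝ, (α • a + β • b) ⬝ᵥ ((!![5, 0, 0; 0, -16/5, 0; 0, 0, -9/5] : Matrix (Fin 3) (Fin 3) ℝ) *ᵥ (α • a + β • b)) ≤ (-(9 / 5)) * (α ^ 2 + β ^ 2)) ∧
      (∃ a b : Fin 3 → ℝ, a ⬝ᵥ a = 1 ∧ b ⬝ᵥ b = 1 ∧ a ⬝ᵥ b = 0 ∧
        ∀ α β : ℝ, 0 * (α ^ 2 + β ^ 2) ≤ (α • a + β • b) ⬝ᵥ (((!![5, 0, 0; 0, -16/5, 0; 0, 0, -9/5] : Matrix (Fin 3) (Fin 3) ℝ) + (!![0, 0, 0; 0, 0, 12/5; 0, 12/5, 0] : Matrix (Fin 3) (Fin 3) ℝ)) *ᵥ (α • a + β • b))) ∧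
      (∃ a b : Fin 3 → ℝ, a ⬝ᵥ a = 1 ∧ b ⬝ᵥ b = 1 ∧ a ⬝ᵥ b = 0 ∧
        ∀ α β : ℝ, 0 * (α ^ 2 + β ^ 2) ≤ (α • a + β • b) ⬝ᵥ (((!![5, 0, 0; 0, -16/5, 0; 0, 0, -9/5] : Matrix (Fin 3) (Fin 3) ℝ) - (!![0, 0, 0; 0, 0, 12/5; 0, 12/5, 0] : Matrix (Fin 3) (Fin 3) ℝ)) *ᵥ (α • a + β • b))) := by
  refine ⟨?_, ?_, ?_, ?_, ?_, ?_, ?_⟩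
  · simp [Matrix.trace, Fin.sum_univ_three]; norm_num
  · simp [Matrix.trace, Fin.sum_univ_three]
  · exact Matrix.IsSymm.ext fun i j => by fin_cases i <;> fin_cases j <;> simp
  · exact Matrix.IsSymm.ext fun i j => by fin_cases i <;> fin_cases j <;> simp
  · refine ⟨![0, 1, 0], ![0, 0, 1], by simp, by simp, by simp, fun α β => ?_⟩
    simp [Matrix.mulVec, dotProduct, Fin.sum_univ_three]
    nlinarith [sq_nonneg α]
  · refine ⟨![1, 0, 0], ![0, 3/5, 4/5], ?_, ?_, ?_, fun α β => ?_⟩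
    · simp [dotProduct, Fin.sum_univ_three]
    · simp [dotProduct, Fin.sum_univ_three]; norm_num
    · simp [dotProduct, Fin.sum_univ_three]
    · simp [Matrix.mulVec, dotProduct, Fin.sum_univ_three]
      nlinarith [sq_nonneg α]
  · refine ⟨![1, 0, 0], ![0, 3/5, -4/5], ?_, ?_, ?_, fun α β => ?_⟩
    · simp [dotProduct, Fin.sum_univ_three]
    · simp [dotProduct, Fin.sum_univ_three]; norm_num
    · simp [dotProduct, Fin.sum_univ_three]
    · simp [Matrix.mulVec, dotProduct, Fin.sum_univ_three]
      nlinarith [sq_nonneg α]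

/-- **The first-order budget at an attained record closes for every `m ≥ 0` with no non-local
payment.** In the Leray gauge and in the eigenframe of the gauge strain `𝔖` (`e₂` middle), the
first-order condition at a space-time maximum `Λ = m` along the flow reads
`0 = −m − m² + σ/3 + w/12 − w₂/4 − h + V` (`σ = |𝔖|²`, `w = |Ω|²`, `w₂ = (Ω·e₂)²`,
`h = ℌ^dev₂₂`, `V = 𝒱₂₂`; from `D_sG = −G − G² − ℌ + 𝒱`, `(G²)₂₂ = Λ² − ¼(|Ω|² − (Ω·e₂)²)`,
`tr ℌ = −tr G² = −|𝔖|² + ½|Ω|²`). With `w = w₂ = h = 0` and the trace-free shape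
`𝔖 = diag(km, m, −(k+1)m)` (`σ = 2m²(k² + k + 1)`), the required viscous term
`V = m + m² − σ/3` is DISSIPATIVE (`≤ 0`) as soon as `2m(k² + k + 1) ≥ 3(1 + m)`, i.e.
`k ≥ k*(m) = (−1 + √(3 + 6/m))/2`: local restricted-Euler self-amplification pays the whole bill
(Vieillefosse 1984; Cantwell 1992). [folklore] -/
theorem localBudget_selfPaid {m k : ℝ} (hm : 0 ≤ m) (hk : 3 * (1 + m) ≤ 2 * m * (k ^ 2 + k + 1)) :
    k * m + m + (-(k + 1) * m) = 0 ∧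
    (k * m) ^ 2 + m ^ 2 + (-(k + 1) * m) ^ 2 = 2 * m ^ 2 * (k ^ 2 + k + 1) ∧
    m + m ^ 2 - ((k * m) ^ 2 + m ^ 2 + (-(k + 1) * m) ^ 2) / 3 ≤ 0 ∧
    0 = -m - m ^ 2 + ((k * m) ^ 2 + m ^ 2 + (-(k + 1) * m) ^ 2) / 3 + 0 / 12 - 0 / 4 - 0 +
      (m + m ^ 2 - ((k * m) ^ 2 + m ^ 2 + (-(k + 1) * m) ^ 2) / 3) := by
  refine ⟨by ring, by ring, ?_, by ring⟩
  nlinarith [mul_le_mul_of_nonneg_left hk hm]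

/-- The calibration points of `k*(m)`: `(m, k) = (1, 1)`, `(1/4, 21/10)`, `(1/8, 31/10)` satisfy
`2m(k² + k + 1) ≥ 3(1 + m)`, while `k = 2` at `m = 1/4` and `k = 3` at `m = 1/8` do not
(`k*(1) = 1`, `k*(1/4) ≈ 2.098`, `k*(1/8) ≈ 3.071`). [folklore] -/
theorem localBudget_thresholds :
    (3 * (1 + (1:ℝ)) ≤ 2 * 1 * ((1:ℝ) ^ 2 + 1 + 1)) ∧
    (3 * (1 + (1/4:ℝ)) ≤ 2 * (1/4) * ((21/10:ℝ) ^ 2 + 21/10 + 1)) ∧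
    ¬ (3 * (1 + (1/4:ℝ)) ≤ 2 * (1/4) * ((2:ℝ) ^ 2 + 2 + 1)) ∧
    (3 * (1 + (1/8:ℝ)) ≤ 2 * (1/8) * ((31/10:ℝ) ^ 2 + 31/10 + 1)) ∧
    ¬ (3 * (1 + (1/8:ℝ)) ≤ 2 * (1/8) * ((3:ℝ) ^ 2 + 3 + 1)) := by
  norm_num

end Summit.NavierStokesRegularity.NavierStokesRegularity.Theorems.ExtremalBiaxialitySubcritical.Negative
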